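import Literature.MathematicalPhysics.QuantumLattice.WilsonFeynmanHellmann
import Literature.MathematicalPhysics.QuantumLattice.ContinuumLimitLGT
import Literature.MathematicalPhysics.QuantumFieldTheory.StrongCouplingTorusSystem
import Summits.Ventures.YMGap.Thresholds.StarLimitLipschitz
import HarnessLib

/-!
# Venture YMGap — THE COUPLING DERIVATIVE OF A TORUS STATE IS A PLAQUETTE-COVARIANCE SUM over one
# fundamental domain of `ℤ^d` (Feynman–Hellmann on the torus, read through the periodic lift)

HONEST FRAMING: venture file of the cell `pub-ymgap` (QuantumFields programme), seat ds-1.  Finite-volume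
(torus) LATTICE bookkeeping for Wilson's lattice gauge theory with a compact gauge group; an exact identity,
no estimate, nothing about the infinite volume, the continuum, or the Clay problem.  It is the first input of
this seat's «C-DIFF» line (differentiability of the strong-coupling state in the coupling).

* `exists_centredLift` — for every torus side `L ≥ 1` and centre `x₀ ∈ ℤ^d` there is a section
  `s : (ℤ/L)^d → ℤ^d` of the projection (`proj ∘ s = id`) which is CENTRED at `x₀`: the periodic sup-distance
  from `y` to `proj x₀` equals `‖s y − x₀‖_∞`, and `s (proj x) = x` whenever `2‖x − x₀‖_∞ < L`.
* `hasDerivAt_integral_torusState` — for every bounded measurable observable `F` of `ℤ^d`, every section `s`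
  of `proj`, and every real coupling `b`:
  `d/db ∫ F d(torusState ρ b L) = Σ_{y ∈ (ℤ/L)^d} Σ_{i<j} Cov_{torusState ρ b L}(F, Re tr ρ(U_{(s y; i, j)}))`
  — the tree's Feynman–Hellmann identity `d/db ∫ F∘lift dμ_b = −Cov_{μ_b}(F∘lift, S_W)`
  (`WilsonFeynmanHellmann.hasDerivAt_integral_wilsonMeasure_eq_neg_covariance`), the Wilson action split into its
  plaquette terms, and each torus plaquette observable written as the lift of the `ℤ^d` plaquette observable at
  the chosen representative (`plaquetteObs_torusLift`).
* `plaquetteObs_fundamentalRep_eq_mul_zdPlaquetteObs` — `Re tr U_q = N · W_q` for the fundamental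
  representation of `SU(N)` (`W_q = (1/N) Re tr U_q`, the tree's `zdPlaquetteObs`).

References (mechanism only): B. Simon, *The Statistical Mechanics of Lattice Gases* I (1993), §II.1
(Feynman–Hellmann / fluctuation–response); E. Seiler, LNP 159 (1982), Ch. 1–2.
-/

noncomputable section

open MeasureTheory ProbabilityTheory Function Finset Filter Topology
open Literature.Probability.LatticeModels (Torus.proj Torus.proj_apply)
open Literature.MathematicalPhysics.QuantumLattice (LGConfig torusLift torusEdge toTorusObservable
  toTorusObservable_apply plaquetteObs plaquetteHolonomyZd continuous_plaquetteObs measurable_plaquetteObs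
  exists_abs_plaquetteObs_le fundamentalRep fundamentalRep_apply continuous_fundamentalRep
  hasDerivAt_integral_wilsonMeasure_eq_neg_covariance)
open Literature.MathematicalPhysics.QuantumFieldTheory

namespace Summit.Ventures.YMGap.CouplingResponse

/-! ### §1 Centred lifts `(ℤ/L)^d → ℤ^d` -/

section Lift

variable {d : ℕ}

/-- Inside the fundamental domain the centred representative of `z mod L` is `z`:
`2|z| < L ⇒ valMinAbs (z̄) = z`. [folklore] -/
theorem valMinAbs_intCast_of_two_mul_natAbs_lt (L : ℕ) [NeZero L] (z : ℤ) (hz : 2 * z.natAbs < L) :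
    ((z : ZMod L)).valMinAbs = z := by
  rw [ZMod.valMinAbs_spec]
  refine ⟨rfl, ?_, ?_⟩ <;> omega

/-- **Centred lifts.**  For every torus side `L ≥ 1` and every centre `x₀ ∈ ℤ^d` there is a section `s` of the
projection `ℤ^d → (ℤ/L)^d` (`proj (s y) = y`) with `‖y − proj x₀‖_{∞,L} = ‖s y − x₀‖_∞` for every torus site
`y` (the periodic sup-distance to `proj x₀` is realised by the representative), and `s (proj x) = x` whenever
`2‖x − x₀‖_∞ < L` (coordinatewise `x₀ + valMinAbs (y − proj x₀)`). [folklore] -/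
theorem exists_centredLift (L : ℕ) [NeZero L] (x₀ : Literature.Probability.LatticeModels.Site d) :
    ∃ s : Site d L → Literature.Probability.LatticeModels.Site d,
      (∀ y, (Torus.proj L (s y) : Site d L) = y) ∧
      (∀ y, torusNorm (y - Torus.proj L x₀) = Literature.Probability.LatticeModels.Site.supNorm (s y - x₀)) ∧
      (∀ x, 2 * Literature.Probability.LatticeModels.Site.supNorm (x - x₀) < L → s (Torus.proj L x) = x) := by
  refine ⟨fun y i => x₀ i + (y i - ((x₀ i : ℤ) : ZMod L)).valMinAbs, fun y => ?_, fun y => ?_, fun x hx => ?_⟩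
  · funext i
    simp [Torus.proj_apply]
  · unfold torusNorm Literature.Probability.LatticeModels.Site.supNorm
    refine Finset.sup_congr rfl fun i _ => ?_
    simp [Torus.proj_apply]
  · funext i
    have hi : 2 * (x i - x₀ i).natAbs < L :=
      lt_of_le_of_lt (Nat.mul_le_mul_left 2 (Literature.Probability.LatticeModels.Site.natAbs_le_supNorm (x - x₀) i)) hx
    have h := valMinAbs_intCast_of_two_mul_natAbs_lt L (x i - x₀ i) hi
    simp only [Torus.proj_apply]
    rw [← Int.cast_sub, h]
    ring

end Lift

/-! ### §2 The coupling derivative of a torus state -/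

section Derivative

variable {d N : ℕ} {G : Type*} [Group G] [TopologicalSpace G] [IsTopologicalGroup G]
  [CompactSpace G] [MeasurableSpace G] [BorelSpace G] [SecondCountableTopology G]
  (ρ : G →* Matrix (Fin N) (Fin N) ℂ) {L : ℕ} [NeZero L]

omit [TopologicalSpace G] [IsTopologicalGroup G] [CompactSpace G] [MeasurableSpace G] [BorelSpace G]
  [SecondCountableTopology G] [NeZero L] in
/-- The `ℤ^d` plaquette observable at `x`, read through the periodic lift, is the torus plaquette observable at
`proj x`. [folklore] -/
theorem plaquetteObs_torusLift (x : Literature.Probability.LatticeModels.Site d) (i j : Fin d)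
    (U : GaugeConfig d L G) :
    plaquetteObs ρ x i j (torusLift L U) =
      (ρ (plaquetteHolonomy U (Torus.proj L x : Site d L) i j)).trace.re := by
  simp only [plaquetteObs, plaquetteHolonomyZd, plaquetteHolonomy, torusLift, torusEdge, Function.comp_apply,
    Site.shift, torusProj_site_add, torusProj_site_single]

/-- **The coupling derivative of a torus state is a plaquette-covariance sum over one fundamental domain.**
For a compact gauge group, a continuous matrix representation `ρ`, a bounded measurable observable `F` of
`ℤ^d`, any section `s` of `proj : ℤ^d → (ℤ/L)^d`, and every real `b`:
`d/db ∫ F d(torusState ρ b L) = Σ_{y} Σ_{i<j} Cov_{torusState ρ b L}(F, Re tr ρ(U_{(s y; i,j)}))`.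
Feynman–Hellmann on the torus (`d/db ∫ F∘lift dμ_b = −Cov(F∘lift, S_W)`, `S_W = Σ_p (N − Re tr ρ(U_p))`), the
covariance split over the plaquettes, and `Re tr ρ(U_p) = (Re tr ρ(U_{(s y;i,j)}))∘lift` for `p = (y; i, j)`.
[folklore] -/
theorem hasDerivAt_integral_torusState (hρ : Continuous ρ) {F : LGConfig d G → ℝ} (hFm : Measurable F)
    {C : ℝ} (hC : ∀ U, |F U| ≤ C) {s : Site d L → Literature.Probability.LatticeModels.Site d}
    (hs : ∀ y, (Torus.proj L (s y) : Site d L) = y) (b : ℝ) :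
    HasDerivAt (fun b : ℝ => ∫ U, F U ∂(torusState (d := d) ρ b L))
      (∑ y : Site d L, ∑ p : {p : Fin d × Fin d // p.1 < p.2},
        cov[F, plaquetteObs ρ (s y) p.1.1 p.1.2; torusState (d := d) ρ b L]) b := by
  classical
  set π : Measure (GaugeConfig d L G) := Measure.pi fun _ : Edge d L => haarProbability G with hπ
  haveI : IsProbabilityMeasure π := by rw [hπ]; infer_instance
  set Ft : GaugeConfig d L G → ℝ := toTorusObservable L F with hFt
  have hFtm : Measurable Ft := hFm.comp (measurable_torusLift L)
  have hint : ∀ b' : ℝ, ∫ U, F U ∂(torusState (d := d) ρ b' L) =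
      ∫ V, Ft V ∂(wilsonMeasure (d := d) (L := L) ρ b') := fun b' => by
    rw [torusState, integral_map (measurable_torusLift L).aemeasurable hFm.aestronglyMeasurable]
    rfl
  have hderiv := hasDerivAt_integral_wilsonMeasure_eq_neg_covariance (d := d) (L := L) hρ
    hFtm.aestronglyMeasurable (ae_of_all π fun V => by rw [Real.norm_eq_abs]; exact hC _) b
  simp_rw [hint]
  convert hderiv using 1
  -- the covariance bookkeeping
  set μ := wilsonMeasure (d := d) (L := L) ρ b with hμ
  haveI : IsProbabilityMeasure μ := isProbabilityMeasure_wilsonMeasure (d := d) (L := L) ρ hρ b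
  -- the torus plaquette observables
  set W : Plaquette d L → GaugeConfig d L G → ℝ :=
    fun q U => (ρ (plaquetteHolonomy U q.1 q.2.1.1 q.2.1.2)).trace.re with hW
  have hWm : ∀ q, Measurable (W q) := fun q =>
    (continuous_trace_re ρ hρ).measurable.comp (measurable_plaquetteHolonomy _ _ _)
  obtain ⟨B, hB⟩ : ∃ B : ℝ, ∀ g : G, |(ρ g).trace.re| ≤ B := by
    obtain ⟨B, hB⟩ := isCompact_univ.exists_bound_of_continuousOn (continuous_trace_re ρ hρ).continuousOn
    exact ⟨B, fun g => by simpa [Real.norm_eq_abs] using hB g (Set.mem_univ g)⟩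
  have hWb : ∀ q U, |W q U| ≤ B := fun q U => hB _
  have hWL2 : ∀ q, MemLp (W q) 2 μ := fun q =>
    memLp_of_bounded (a := -B) (b := B) (ae_of_all _ fun U => abs_le.1 (hWb q U))
      (hWm q).aestronglyMeasurable 2
  have hFtL2 : MemLp Ft 2 μ :=
    memLp_of_bounded (a := -C) (b := C) (ae_of_all _ fun U => abs_le.1 (hC _)) hFtm.aestronglyMeasurable 2
  set X : Plaquette d L → GaugeConfig d L G → ℝ := fun q U => (N : ℝ) - W q U with hX
  have hXL2 : ∀ q, MemLp (X q) 2 μ := fun q => (memLp_const (N : ℝ)).sub (hWL2 q)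
  have hact : (fun U : GaugeConfig d L G => wilsonAction ρ U) = fun U => ∑ q, X q U := by
    funext U; rfl
  have hcov : cov[Ft, fun U : GaugeConfig d L G => wilsonAction ρ U; μ] = -∑ q, cov[Ft, W q; μ] := by
    rw [hact, covariance_fun_sum_right (X := X) hXL2 hFtL2, ← Finset.sum_neg_distrib]
    refine Finset.sum_congr rfl fun q _ => ?_
    simp only [hX]
    exact covariance_const_sub_right ((hWL2 q).integrable one_le_two) _
  rw [hcov, neg_neg, Fintype.sum_prod_type]
  refine Finset.sum_congr rfl fun y _ => Finset.sum_congr rfl fun p _ => ?_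
  -- one plaquette: push the covariance through the lift
  have hmeasP : Measurable (plaquetteObs ρ (s y) p.1.1 p.1.2 : LGConfig d G → ℝ) :=
    measurable_plaquetteObs ρ hρ _ _ _
  rw [torusState, covariance_map hFm.aestronglyMeasurable hmeasP.aestronglyMeasurable
    (measurable_torusLift L).aemeasurable]
  congr 1
  funext U
  simp only [Function.comp_apply, plaquetteObs_torusLift, hs, hW]

end Derivative

/-! ### §3 `SU(N)`: the unnormalised and the normalised plaquette observable -/

section SUN

variable {d N : ℕ}

/-- For the fundamental representation of `SU(N)`: `Re tr U_q = N · W_q`, `W_q = (1/N) Re tr U_q` the tree's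
normalised plaquette observable `zdPlaquetteObs` (for `N = 0` both sides vanish). [folklore] -/
theorem plaquetteObs_fundamentalRep_eq_mul_zdPlaquetteObs (x : Literature.Probability.LatticeModels.Site d)
    (i j : Fin d) (U : LGConfig d (Matrix.specialUnitaryGroup (Fin N) ℂ)) :
    plaquetteObs (fundamentalRep (Fin N)) x i j U = N * zdPlaquetteObs (fundamentalRep (Fin N)) x i j U := by
  have h : plaquetteObs (fundamentalRep (Fin N)) x i j U =
      ((fundamentalRep (Fin N)) (ZdGaugeConfig.plaquette U x i j)).trace.re := rfl
  rw [zdPlaquetteObs, h]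
  rcases Nat.eq_zero_or_pos N with hN | hN
  · subst hN
    simp [Matrix.trace]
  · have hN' : (N : ℝ) ≠ 0 := by exact_mod_cast hN.ne'
    rw [← mul_assoc, mul_inv_cancel₀ hN', one_mul]

/-- **`SU(N)` form of the torus derivative**: with the normalised plaquette observable `W_q = (1/N) Re tr U_q`,
`d/db ∫ F d(torusState b L) = Σ_{y} Σ_{i<j} N · Cov_{torusState b L}(F, W_{(s y; i,j)})`. [folklore] -/
theorem hasDerivAt_integral_torusState_SU {L : ℕ} [NeZero L]
    {F : LGConfig d (Matrix.specialUnitaryGroup (Fin N) ℂ) → ℝ} (hFm : Measurable F)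
    {C : ℝ} (hC : ∀ U, |F U| ≤ C) {s : Site d L → Literature.Probability.LatticeModels.Site d}
    (hs : ∀ y, (Torus.proj L (s y) : Site d L) = y) (b : ℝ) :
    HasDerivAt (fun b : ℝ => ∫ U, F U ∂(torusState (d := d) (fundamentalRep (Fin N)) b L))
      (∑ y : Site d L, ∑ p : {p : Fin d × Fin d // p.1 < p.2},
        (N : ℝ) * cov[F, zdPlaquetteObs (fundamentalRep (Fin N)) (s y) p.1.1 p.1.2;
          torusState (d := d) (fundamentalRep (Fin N)) b L]) b := by
  haveI : SecondCountableTopology (Matrix (Fin N) (Fin N) ℂ) :=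
    inferInstanceAs (SecondCountableTopology (Fin N → Fin N → ℂ))
  haveI : SecondCountableTopology (Matrix.specialUnitaryGroup (Fin N) ℂ) :=
    Topology.IsEmbedding.subtypeVal.secondCountableTopology
  have h := hasDerivAt_integral_torusState (d := d) (L := L) (fundamentalRep (Fin N))
    (continuous_fundamentalRep (Fin N)) hFm hC hs b
  convert h using 3 with y _ p _
  rw [← covariance_const_mul_right]
  congr 1
  funext U
  rw [plaquetteObs_fundamentalRep_eq_mul_zdPlaquetteObs]

end SUN

end Summit.Ventures.YMGap.CouplingResponse

end
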